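import Summits.QuantumFields.YangMills.Theorems.IR.AfPincerUcTypChainReduced
import Summits.QuantumFields.YangMills.Theorems.IR.Negative.TypShellCondFalseAllG.Laplace
import Literature.MathematicalPhysics.QuantumLattice.LatticeGaugeDLRGibbsProofs
import HarnessLib

/-!
# Crux `IR` (stmt-QuantumFields-19354), line `af-pincer-Uc-sharp` — NEGATIVE side of conjunct (ii), part 1/2:
# chained ground states kill clause (ii) for `TypChain` (and kernel plaquette sparseness) at a fixed frame

Negative knowledge for item `stmt-QuantumFields-19354` (`--supports`; closes no stub; the item's verdict of record stays NOT-REFUTED).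
Author: refuter `ym-19354-disprove-1` GEN 11, answering the LEAD `ym-lead-19354-af-pincer` g3's closing ask W3 (NO-SUCCESSOR
2026-08-27T18:11:52Z; FORCING-NUMERICS-g3 rev 2 §4 (6)): *"typed negative on conjunct (ii) / `KernelPlaqSparse` — uniform-flux exterior at
level `θ⁻`, edge chain, `θ ≲ 0.3`"*.  The open stub `stub_onsetSharpSC : OnsetSharpUKPcSC` is served through the supplier formats
`TypChainSharpSC` (`AfPincerUcTypChainSupplier`) and `TypChainReducedAtSC` (`AfPincerUcTypChainReduced`), whose conjunct (ii) is
`ClauseIIukp r.ρ β w δ (TypChain r.ρ θ w ℓ₀)` resp. `KernelPlaqSparse r.ρ β w θ ℓ₀ (e^{−κβ})` ON EVERY FRAME of the supplier's mesh.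
Part 2/2 (`TypChainSuppliersAvoidFluxEdgeChainWire.lean`, independent of this file) types the mesh-uniform WIRE and the supplier calibration.

## What is PROVED here (no `sorry`; axioms ⊆ {propext, Classical.choice, Quot.sound})
* §1 `chainFree` — a continuous `[0,1]`-valued CHAIN DETECTOR on configurations: `= 1` on `TypChain ρ θ w ℓ₀ c`, `= 0` on configurations
  carrying a `(θ + m)`-bad chain of extent `≥ ℓ₀` in the cell (`hasBadChainAmong_iff_exists_support`: chains ⇔ an all-bad chain SUPPORT,
  a finite family).
* §2 THE KERNEL LAPLACE ENGINE `kernel_integral_le_of_groundStates` ∕ `kernel_measure_le_of_groundStates`: for the DLR kernel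
  `γ_Λ^β(· | ζ)` (`ymSpecification`), a continuous observable bounded by `r` at every GROUND STATE of the interior energy
  `x ↦ S_Λ(x ζ_{Λᶜ})`, for all exteriors `ζ` of a closed family `K`, has kernel mean `≤ r + s` for `β ≥ β₀(s)` on an OPEN neighbourhood of
  `K`; hence an event with such a majorant vanishing at ground states has kernel probability `≤ s` there.  (The tree's abstract uniform
  Laplace bound `FixedMeshAllG.laplace_upper_uniform` on the compact fibre `G^Λ` + `integral_ymSpecification`; single exteriors via
  `closure {ζ}`, `eq_of_mem_closure_singleton` — no separation axiom on `G`.)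
* §3 AT A FIXED FRAME: `GroundStatesChained ρ θ m w ℓ₀ c ζ` (every ground state of the cell's interior energy at exterior `ζ` carries a
  `(θ+m)`-bad chain of extent `≥ ℓ₀` in the cell) ⇒ `γ^β_{cell}(ζ')(TypChain) ≤ s` for `β ≥ β₀` and `ζ'` near `ζ`
  (`kernel_typChain_le_of_groundStatesChained[_at]`) ⇒ with a guard-clean `ζ`, **`¬ ClauseIIukp ρ β w δ (TypChain ρ θ w ℓ₀)` for every
  `0 ≤ δ < 1` and all large `β`** (`not_clauseIIukp_typChain_of_groundStatesChained`); and `GroundStatesForce … p ζ` (ground states force ONE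
  own plaquette to action `≥ θ + m`) ⇒ **`¬ KernelPlaqSparse ρ β w θ ℓ₀ q` for every `0 ≤ q < 1`** (`not_kernelPlaqSparse_of_groundStatesForce`).

## What is NOT proved, and the honest reading
* `GroundStatesChained` ∕ `GroundStatesForce` are finite-dimensional, zero-temperature HYPOTHESES — what the LEAD's cooling numerics assert for
  `SU(2)`, `θ ≲ 0.3` (forced own action `r·s` on cell edges/corners under the uniform sub-threshold flux exterior: `r = 2.1–2.6 @ s = 0.1`,
  `1.22–1.37 @ 0.25`, `≈ 1.0 @ 0.35`, corner-ness `0/1/2/3/4 ↦ 0.4/0.87/1.5/1.85/1.8`, job j286350) — certified for no `(G, ρ, θ)` in the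
  tree (a non-convex minimisation over `G^{4b⁴}`; certifiable in principle by interval arithmetic at small `b`).
* FIXED MESH ONLY: `β₀` comes from compactness of `G^{cell}` and depends on the frame; the suppliers' sharp mesh is `b ≍ e^{Cβ}`, so this does
  NOT refute `TypChainSharpSC`, `OnsetSharpUKPcSC` or `IR` — the mesh-uniform version is the WIRE of part 2/2, whose uniformity in `b` is open.
* Reading for suppliers: conjunct (ii) for `TypChain` at threshold `θ` dies at a frame as soon as ONE guard-clean exterior chains the cell's
  ground states; print `θ` above the forcing level (`θ_force(SU(2)) ≈ 0.36` numerically), or re-cut the class («TypChainDeep»: chains at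
  depth `≥ 2` from the cell boundary, where the numerics see screening `≤ 0.03·s`).
HONEST FRAMING: negative bookkeeping around ONE open stub of a CONDITIONAL chain; nothing of a mass gap; not Clay.
-/

set_option autoImplicit false

noncomputable section

open MeasureTheory Filter Topology
open Literature.MathematicalPhysics.QuantumFieldTheory hiding ZdEdge
open Literature.MathematicalPhysics.QuantumLattice
open Literature.Probability.LatticeModels
open Summit.QuantumFields.YangMills.Cruxes.IR.Tempered (cellEdges regionEdges)
open Summit.QuantumFields.YangMills.Theorems.OddTorusChessboard (cellPlaqs plaqAction plaqAction_congr measurable_plaqAction)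
open Summit.QuantumFields.YangMills.Cruxes.IR.FixedMeshAllG (laplace_upper_uniform)

namespace Summit.QuantumFields.YangMills.Cruxes.IR.AfPincerUc.SharpLanes.GroundStateForcing

open Summit.QuantumFields.YangMills.Cruxes.IR.AfPincerUc
open Summit.QuantumFields.YangMills.Cruxes.IR.AfPincerUc.SharpLanes

/-! ## §1 A continuous chain detector -/
section Detector

variable {G : Type} [Group G] {N : ℕ} (ρ : G →* Matrix (Fin N) (Fin N) ℂ)

/-- Soft badness of the plaquette `p` at threshold `θ` with margin `m`: the clamp to `[0, 1]` of `(s_p(U) − θ)/m`; it is `0` when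
`s_p(U) < θ` (in fact `≤ θ`) and `1` when `s_p(U) ≥ θ + m`. -/
def softBad (θ m : ℝ) (p : ZdPlaquette 4) (U : LGConfig 4 G) : ℝ :=
  max 0 (min 1 ((plaqAction ρ p U - θ) / m))

/-- Soft badness is nonnegative. -/
theorem softBad_nonneg (θ m : ℝ) (p : ZdPlaquette 4) (U : LGConfig 4 G) : 0 ≤ softBad ρ θ m p U := le_max_left _ _

/-- Soft badness is at most `1`. -/
theorem softBad_le_one (θ m : ℝ) (p : ZdPlaquette 4) (U : LGConfig 4 G) : softBad ρ θ m p U ≤ 1 :=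
  max_le zero_le_one (min_le_left _ _)

/-- Soft badness vanishes on plaquettes of action `< θ`. -/
theorem softBad_eq_zero_of_lt {θ m : ℝ} (hm : 0 < m) {p : ZdPlaquette 4} {U : LGConfig 4 G} (h : plaqAction ρ p U < θ) :
    softBad ρ θ m p U = 0 := by
  unfold softBad
  have : (plaqAction ρ p U - θ) / m ≤ 0 := div_nonpos_of_nonpos_of_nonneg (by linarith) hm.le
  exact max_eq_left ((min_le_right _ _).trans this)

/-- Soft badness is `1` on plaquettes of action `≥ θ + m`. -/
theorem softBad_eq_one_of_le {θ m : ℝ} (hm : 0 < m) {p : ZdPlaquette 4} {U : LGConfig 4 G} (h : θ + m ≤ plaqAction ρ p U) :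
    softBad ρ θ m p U = 1 := by
  unfold softBad
  have : 1 ≤ (plaqAction ρ p U - θ) / m := by rw [le_div_iff₀ hm]; linarith
  rw [min_eq_left this, max_eq_right zero_le_one]

open Classical in
/-- The possible SUPPORTS of a long bad chain in the cell `c`: the plaquette sets `R ⊆ cellPlaqs w c` that carry a chain shape (steps `≤ 2`
in `ℓ∞`, end-to-end extent `≥ ℓ₀`) — a finite family. -/
def chainSupports (w : Fin 4 → ℤ → ℤ) (c : Fin 4 → ℤ) (ℓ₀ : ℕ) : Finset (Finset (ZdPlaquette 4)) :=
  (cellPlaqs w c).powerset.filter fun R => ∃ (k : ℕ) (ch : Fin (k + 1) → ZdPlaquette 4), (∀ i, ch i ∈ R) ∧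
    (∀ i : Fin k, supNormZ4 ((ch i.castSucc).1 - (ch i.succ).1) ≤ 2) ∧ ℓ₀ ≤ supNormZ4 ((ch 0).1 - (ch (Fin.last k)).1)

/-- A `θ`-bad chain of extent `≥ ℓ` among the cell's plaquettes EXISTS iff some chain support is entirely `θ`-bad. -/
theorem hasBadChainAmong_iff_exists_support (θ : ℝ) (w : Fin 4 → ℤ → ℤ) (c : Fin 4 → ℤ) (ℓ : ℕ) (U : LGConfig 4 G) :
    HasBadChainAmong ρ θ (↑(cellPlaqs w c) : Set (ZdPlaquette 4)) ℓ U ↔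
      ∃ R ∈ chainSupports w c ℓ, ∀ p ∈ R, θ ≤ plaqAction ρ p U := by
  classical
  constructor
  · rintro ⟨k, ch, hin, hbad, hstep, hext⟩
    refine ⟨Finset.univ.image ch, ?_, ?_⟩
    · refine Finset.mem_filter.2 ⟨Finset.mem_powerset.2 ?_, k, ch, fun i => Finset.mem_image_of_mem ch (Finset.mem_univ i),
        hstep, hext⟩
      intro p hp
      obtain ⟨i, -, rfl⟩ := Finset.mem_image.1 hp
      exact Finset.mem_coe.1 (hin i)
    · intro p hp
      obtain ⟨i, -, rfl⟩ := Finset.mem_image.1 hp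
      exact hbad i
  · rintro ⟨R, hR, hall⟩
    obtain ⟨hRsub, k, ch, hchR, hstep, hext⟩ := Finset.mem_filter.1 hR
    exact ⟨k, ch, fun i => Finset.mem_coe.2 (Finset.mem_powerset.1 hRsub (hchR i)), fun i => hall _ (hchR i), hstep, hext⟩

/-- **The chain detector** `g_{θ,m}(U) = ∏_{R} (1 − ∏_{p ∈ R} softBad_{θ,m}(p, U))` over the chain supports `R` of the cell: a
continuous `[0, 1]`-valued function, `= 1` on `TypChain ρ θ w ℓ₀ c` and `= 0` on configurations carrying a `(θ + m)`-bad chain of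
extent `≥ ℓ₀` in the cell. -/
def chainFree (θ m : ℝ) (w : Fin 4 → ℤ → ℤ) (ℓ₀ : ℕ) (c : Fin 4 → ℤ) (U : LGConfig 4 G) : ℝ :=
  ∏ R ∈ chainSupports w c ℓ₀, (1 - ∏ p ∈ R, softBad ρ θ m p U)

/-- A product of soft badnesses lies in `[0, 1]`. -/
theorem prod_softBad_mem_Icc (θ m : ℝ) (R : Finset (ZdPlaquette 4)) (U : LGConfig 4 G) :
    0 ≤ ∏ p ∈ R, softBad ρ θ m p U ∧ ∏ p ∈ R, softBad ρ θ m p U ≤ 1 :=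
  ⟨Finset.prod_nonneg fun p _ => softBad_nonneg ρ θ m p U,
    Finset.prod_le_one (fun p _ => softBad_nonneg ρ θ m p U) fun p _ => softBad_le_one ρ θ m p U⟩

/-- The chain detector is nonnegative. -/
theorem chainFree_nonneg (θ m : ℝ) (w : Fin 4 → ℤ → ℤ) (ℓ₀ : ℕ) (c : Fin 4 → ℤ) (U : LGConfig 4 G) :
    0 ≤ chainFree ρ θ m w ℓ₀ c U :=
  Finset.prod_nonneg fun R _ => by linarith [(prod_softBad_mem_Icc ρ θ m R U).2]

/-- On the short-chain class the detector reads `1`: every chain support contains a plaquette of action `< θ`. -/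
theorem chainFree_eq_one_of_mem_typChain {θ m : ℝ} (hm : 0 < m) {w : Fin 4 → ℤ → ℤ} {ℓ₀ : ℕ} {c : Fin 4 → ℤ}
    {U : LGConfig 4 G} (hU : U ∈ TypChain ρ θ w ℓ₀ c) : chainFree ρ θ m w ℓ₀ c U = 1 := by
  refine Finset.prod_eq_one fun R hR => ?_
  have hex : ∃ p ∈ R, plaqAction ρ p U < θ := by
    by_contra h
    push Not at h
    exact hU ((hasBadChainAmong_iff_exists_support ρ θ w c ℓ₀ U).2 ⟨R, hR, h⟩)
  obtain ⟨p, hp, hlt⟩ := hex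
  rw [Finset.prod_eq_zero hp (softBad_eq_zero_of_lt ρ hm hlt), sub_zero]

/-- On a configuration carrying a `(θ + m)`-bad long chain in the cell the detector reads `0`. -/
theorem chainFree_eq_zero_of_chain {θ m : ℝ} (hm : 0 < m) {w : Fin 4 → ℤ → ℤ} {ℓ₀ : ℕ} {c : Fin 4 → ℤ}
    {U : LGConfig 4 G} (hU : HasBadChainAmong ρ (θ + m) (↑(cellPlaqs w c) : Set (ZdPlaquette 4)) ℓ₀ U) :
    chainFree ρ θ m w ℓ₀ c U = 0 := by
  obtain ⟨R, hR, hall⟩ := (hasBadChainAmong_iff_exists_support ρ (θ + m) w c ℓ₀ U).1 hU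
  refine Finset.prod_eq_zero hR ?_
  rw [Finset.prod_eq_one fun p hp => softBad_eq_one_of_le ρ hm (hall p hp), sub_self]

variable [TopologicalSpace G] [IsTopologicalGroup G]

/-- Continuity of the soft badness (continuous `ρ`). -/
theorem continuous_softBad (hρ : Continuous ρ) (θ m : ℝ) (p : ZdPlaquette 4) : Continuous (softBad (G := G) ρ θ m p) := by
  have hc : Continuous (plaqAction (G := G) ρ p) := continuous_const.sub (continuous_plaquetteObs ρ hρ p.1 p.2.1.1 p.2.1.2)
  unfold softBad
  exact continuous_const.max (continuous_const.min ((hc.sub continuous_const).div_const m))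

/-- Continuity of the chain detector (continuous `ρ`). -/
theorem continuous_chainFree (hρ : Continuous ρ) (θ m : ℝ) (w : Fin 4 → ℤ → ℤ) (ℓ₀ : ℕ) (c : Fin 4 → ℤ) :
    Continuous (chainFree (G := G) ρ θ m w ℓ₀ c) := by
  unfold chainFree
  exact continuous_finsetProd _ fun R _ => continuous_const.sub (continuous_finsetProd _ fun p _ => continuous_softBad ρ hρ θ m p)

end Detector

/-! ## §2 The kernel Laplace engine: ground states of the interior energy control the DLR kernel as `β → ∞` -/
section Engine

variable {G : Type} [Group G] [TopologicalSpace G] [IsTopologicalGroup G] [CompactSpace G]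
  [MeasurableSpace G] [BorelSpace G] [SecondCountableTopology G] {N : ℕ} (ρ : G →* Matrix (Fin N) (Fin N) ℂ)

/-- The INTERIOR ENERGY of the finite link set `Λ` at exterior `ζ`, as a function of the interior links `x : Λ → G`:
`S_Λ(x ζ_{Λᶜ})`, the exponent of the DLR kernel `γ_Λ^β(· | ζ) ∝ e^{−β S_Λ}` (tree `ymSpecification`, `integral_ymSpecification`). -/
def interiorEnergy (Λ : Finset (ZdEdge 4)) (ζ : LGConfig 4 G) (x : ↥Λ → G) : ℝ :=
  wilsonBoundaryAction ρ Λ (glueWith Λ x ζ)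

/-- `x` is a GROUND STATE (global minimiser over the compact fibre `G^Λ`) of the interior energy at exterior `ζ`. -/
def IsGroundState (Λ : Finset (ZdEdge 4)) (ζ : LGConfig 4 G) (x : ↥Λ → G) : Prop :=
  ∀ x' : ↥Λ → G, interiorEnergy ρ Λ ζ x ≤ interiorEnergy ρ Λ ζ x'

/-- **Kernel Laplace bound (PROVED; uniform on a closed family of exteriors).**  `K` a closed set of exteriors, `g` a continuous observable
with `g(x ζ_{Λᶜ}) ≤ r` at every ground state `x` of the interior energy at every `ζ ∈ K`.  Then for every `s > 0` there are an OPEN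
`O ⊇ K` and `β₀` with `∫ g dγ_Λ^β(· | ζ) ≤ r + s` for all `β ≥ β₀` and all `ζ ∈ O`.  (Engine: the tree's abstract uniform Laplace upper bound
`FixedMeshAllG.laplace_upper_uniform` on the fibre `G^Λ` with product Haar, parameter space the compact exterior space, plus the kernel's
integral formula `integral_ymSpecification`.)  SOFT: `β₀` comes from compactness, no rate. -/
theorem kernel_integral_le_of_groundStates (hρ : Continuous ρ) (Λ : Finset (ZdEdge 4)) {K : Set (LGConfig 4 G)} (hK : IsClosed K)
    {g : LGConfig 4 G → ℝ} (hg : Continuous g) {r : ℝ}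
    (hmin : ∀ ζ ∈ K, ∀ x : ↥Λ → G, IsGroundState ρ Λ ζ x → g (glueWith Λ x ζ) ≤ r) {s : ℝ} (hs : 0 < s) :
    ∃ O : Set (LGConfig 4 G), IsOpen O ∧ K ⊆ O ∧
      ∃ β₀ : ℝ, ∀ β : ℝ, β₀ ≤ β → ∀ ζ ∈ O, ∫ U, g U ∂(ymSpecification ρ β Λ ζ) ≤ r + s := by
  haveI : (haarProbability G).IsOpenPosMeasure := by unfold haarProbability; infer_instance
  have hgl := continuous_glueWith_prod (G := G) Λ
  have hS : Continuous fun p : LGConfig 4 G × (↥Λ → G) => wilsonBoundaryAction ρ Λ (glueWith Λ p.2 p.1) :=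
    (continuous_wilsonBoundaryAction ρ hρ Λ).comp hgl
  have hg' : Continuous fun p : LGConfig 4 G × (↥Λ → G) => g (glueWith Λ p.2 p.1) := hg.comp hgl
  have hmin' : ∀ y ∈ K, ∀ x : ↥Λ → G,
      (∀ x', (fun p : LGConfig 4 G × (↥Λ → G) => wilsonBoundaryAction ρ Λ (glueWith Λ p.2 p.1)) (y, x) ≤
        (fun p : LGConfig 4 G × (↥Λ → G) => wilsonBoundaryAction ρ Λ (glueWith Λ p.2 p.1)) (y, x')) →
      (fun p : LGConfig 4 G × (↥Λ → G) => g (glueWith Λ p.2 p.1)) (y, x) ≤ r :=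
    fun y hy x hx => hmin y hy x hx
  obtain ⟨O, hO, hKO, β₀, hβ₀⟩ := laplace_upper_uniform (Measure.pi fun _ : ↥Λ => haarProbability G) hS hg' hK hmin' hs
  refine ⟨O, hO, hKO, β₀, fun β hβ ζ hζ => ?_⟩
  have hL := hβ₀ β hβ ζ hζ
  rw [integral_ymSpecification ρ hρ β Λ hg.measurable, div_le_iff₀ (normaliser_pos ρ hρ β Λ ζ)]
  exact hL

/-- **Kernel probability bound (PROVED).**  If a measurable event `A` has a continuous nonnegative majorant `g` (`1 ≤ g` on `A`) which
VANISHES at (the glued configurations of) all ground states for exteriors in the closed family `K`, then `γ_Λ^β(A | ζ) ≤ s` for every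
`s > 0`, all `β ≥ β₀(s)` and all `ζ` in an OPEN neighbourhood `O ⊇ K`. -/
theorem kernel_measure_le_of_groundStates (hρ : Continuous ρ) (Λ : Finset (ZdEdge 4)) {K : Set (LGConfig 4 G)} (hK : IsClosed K)
    {A : Set (LGConfig 4 G)} (hA : MeasurableSet A) {g : LGConfig 4 G → ℝ} (hg : Continuous g) (hgA : ∀ U ∈ A, 1 ≤ g U)
    (hg0 : ∀ U, 0 ≤ g U) (hmin : ∀ ζ ∈ K, ∀ x : ↥Λ → G, IsGroundState ρ Λ ζ x → g (glueWith Λ x ζ) ≤ 0) {s : ℝ}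
    (hs : 0 < s) :
    ∃ O : Set (LGConfig 4 G), IsOpen O ∧ K ⊆ O ∧
      ∃ β₀ : ℝ, ∀ β : ℝ, β₀ ≤ β → ∀ ζ ∈ O, (ymSpecification ρ β Λ ζ) A ≤ ENNReal.ofReal s := by
  obtain ⟨O, hO, hKO, β₀, h⟩ := kernel_integral_le_of_groundStates ρ hρ Λ hK hg hmin hs
  refine ⟨O, hO, hKO, β₀, fun β hβ ζ hζ => ?_⟩
  haveI := isProbabilityMeasure_ymSpecification ρ hρ β Λ ζ
  obtain ⟨C, hC⟩ := exists_bound_of_continuous hg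
  have hgi : Integrable g (ymSpecification ρ β Λ ζ) := integrable_of_bound hg.aestronglyMeasurable hC
  have hind : ∫ U, A.indicator (1 : LGConfig 4 G → ℝ) U ∂(ymSpecification ρ β Λ ζ) ≤ ∫ U, g U ∂(ymSpecification ρ β Λ ζ) := by
    refine integral_mono ((integrable_const (1 : ℝ)).indicator hA) hgi fun U => ?_
    by_cases hU : U ∈ A
    · simpa [Set.indicator_of_mem hU] using hgA U hU
    · simpa [Set.indicator_of_notMem hU] using hg0 U
  rw [integral_indicator_one hA] at hind
  have hreal : (ymSpecification ρ β Λ ζ).real A ≤ s := by linarith [h β hβ ζ hζ]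
  calc (ymSpecification ρ β Λ ζ) A = ENNReal.ofReal ((ymSpecification ρ β Λ ζ).real A) := (ofReal_measureReal (by finiteness)).symm
    _ ≤ ENNReal.ofReal s := ENNReal.ofReal_le_ofReal hreal

omit [Group G] [IsTopologicalGroup G] [CompactSpace G] [MeasurableSpace G] [BorelSpace G] [SecondCountableTopology G] in
/-- Exteriors in the closure of `{ζ}` are thermodynamically identical to `ζ`: every continuous observable of the glued configuration
agrees (specialisation maps into the `T₁` space `ℝ`).  This lets single-exterior statements use the closed family `closure {ζ}` with NO
separation hypothesis on `G`. -/
theorem eq_of_mem_closure_singleton {ζ y : LGConfig 4 G} (hy : y ∈ closure ({ζ} : Set (LGConfig 4 G))) (Λ : Finset (ZdEdge 4))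
    {f : LGConfig 4 G → ℝ} (hf : Continuous f) (x : ↥Λ → G) : f (glueWith Λ x y) = f (glueWith Λ x ζ) := by
  have hsp : ζ ⤳ y := specializes_iff_mem_closure.2 hy
  have hc : Continuous fun η : LGConfig 4 G => f (glueWith Λ x η) :=
    hf.comp ((continuous_glueWith_prod Λ).comp (Continuous.prodMk_left x))
  exact ((hsp.map hc).eq).symm

omit [CompactSpace G] [MeasurableSpace G] [BorelSpace G] [SecondCountableTopology G] in
/-- Ground states at an exterior in `closure {ζ}` are the ground states at `ζ`. -/
theorem isGroundState_iff_of_mem_closure_singleton (hρ : Continuous ρ) {ζ y : LGConfig 4 G}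
    (hy : y ∈ closure ({ζ} : Set (LGConfig 4 G))) (Λ : Finset (ZdEdge 4)) (x : ↥Λ → G) :
    IsGroundState ρ Λ y x ↔ IsGroundState ρ Λ ζ x := by
  have he : ∀ x', interiorEnergy ρ Λ y x' = interiorEnergy ρ Λ ζ x' := fun x' =>
    eq_of_mem_closure_singleton hy Λ (continuous_wilsonBoundaryAction ρ hρ Λ) x'
  simp only [IsGroundState, he]

end Engine

/-! ## §3 Conjunct (ii) for `TypChain` and kernel plaquette sparseness DIE at a fixed frame when ground states carry edge chains -/
section FixedFrame

variable {G : Type} [Group G] [TopologicalSpace G] [IsTopologicalGroup G] [CompactSpace G]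
  [MeasurableSpace G] [BorelSpace G] [SecondCountableTopology G] {N : ℕ} (ρ : G →* Matrix (Fin N) (Fin N) ℂ)

/-- **HYPOTHESIS «ground states are chained» (zero temperature, finite-dimensional, in principle certifiable).**  At exterior `ζ`, EVERY
ground state of the interior energy of the cell `c` of the frame `w` (region `regionEdges w {c}`, i.e. the cell's own links, all other links
frozen to `ζ`) carries a `(θ + m)`-bad chain of extent `≥ ℓ₀` among the cell's plaquettes.  This is the typed form of the LEAD's cooling
numerics (FORCING-NUMERICS-g3 rev 2 §4 (6), job j286350): under the uniform sub-threshold flux exterior at level `s = θ⁻` the minimiser's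
own plaquettes on cell EDGES/CORNERS are driven to action `r·s` with `r = 2.1–2.6` at `s = 0.1`, `1.22–1.37` at `s = 0.25`, `≈ 1.0` at
`s = 0.35` (corner-ness `0/1/2/3/4 ↦ r = 0.4/0.87/1.5/1.85/1.8`), i.e. forced `θ`-bad along whole edges (extent `≍ b ≥ ℓ₀`) for `θ ≲ 0.3`. -/
def GroundStatesChained (θ m : ℝ) (w : Fin 4 → ℤ → ℤ) (ℓ₀ : ℕ) (c : Fin 4 → ℤ) (ζ : LGConfig 4 G) : Prop :=
  ∀ x : ↥(regionEdges w {c}) → G, IsGroundState ρ (regionEdges w {c}) ζ x →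
    HasBadChainAmong ρ (θ + m) (↑(cellPlaqs w c) : Set (ZdPlaquette 4)) ℓ₀ (glueWith (regionEdges w {c}) x ζ)

/-- **HYPOTHESIS «ground states force the plaquette `p`»**: at exterior `ζ`, every ground state of the cell's interior energy has
`s_p ≥ θ + m` (one edge/corner plaquette of the numerics). -/
def GroundStatesForce (θ m : ℝ) (w : Fin 4 → ℤ → ℤ) (c : Fin 4 → ℤ) (p : ZdPlaquette 4) (ζ : LGConfig 4 G) : Prop :=
  ∀ x : ↥(regionEdges w {c}) → G, IsGroundState ρ (regionEdges w {c}) ζ x →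
    θ + m ≤ plaqAction ρ p (glueWith (regionEdges w {c}) x ζ)

omit [TopologicalSpace G] [IsTopologicalGroup G] [CompactSpace G] [MeasurableSpace G] [BorelSpace G] [SecondCountableTopology G] in
/-- An exterior with NO `θ`-bad plaquette among a cell's plaquettes is short-chain typical there (the format's guard is met trivially by the
uniform sub-threshold flux exterior of the numerics). -/
theorem mem_typChain_of_forall_lt {θ : ℝ} {w : Fin 4 → ℤ → ℤ} {ℓ₀ : ℕ} {c : Fin 4 → ℤ} {ζ : LGConfig 4 G}
    (h : ∀ p ∈ cellPlaqs w c, plaqAction ρ p ζ < θ) : ζ ∈ TypChain ρ θ w ℓ₀ c := by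
  rintro ⟨k, ch, hin, hbad, -, -⟩
  exact absurd (hbad 0) (not_le.2 (h _ (Finset.mem_coe.1 (hin 0))))

/-- **Chained ground states empty the short-chain class (PROVED; closed family of exteriors).**  If the ground states are chained at every
exterior of the closed family `K`, then for every `s > 0`: `γ^β_{cell c}(ζ)(TypChain ρ θ w ℓ₀ c) ≤ s` for all `β ≥ β₀` and all `ζ` in an OPEN
neighbourhood `O ⊇ K` of exteriors (robustness: the killing exteriors have nonempty interior). -/
theorem kernel_typChain_le_of_groundStatesChained (hρ : Continuous ρ) {θ m : ℝ} (hm : 0 < m) (w : Fin 4 → ℤ → ℤ) (ℓ₀ : ℕ)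
    (c : Fin 4 → ℤ) {K : Set (LGConfig 4 G)} (hK : IsClosed K) (hGS : ∀ ζ ∈ K, GroundStatesChained ρ θ m w ℓ₀ c ζ) {s : ℝ}
    (hs : 0 < s) :
    ∃ O : Set (LGConfig 4 G), IsOpen O ∧ K ⊆ O ∧ ∃ β₀ : ℝ, ∀ β : ℝ, β₀ ≤ β → ∀ ζ ∈ O,
      (ymSpecification ρ β (regionEdges w {c}) ζ) (TypChain ρ θ w ℓ₀ c) ≤ ENNReal.ofReal s :=
  kernel_measure_le_of_groundStates ρ hρ _ hK (measurableSet_typChain ρ hρ θ w ℓ₀ c) (continuous_chainFree ρ hρ θ m w ℓ₀ c)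
    (fun _ hU => (chainFree_eq_one_of_mem_typChain ρ hm hU).ge) (chainFree_nonneg ρ θ m w ℓ₀ c)
    (fun ζ hζ x hx => (chainFree_eq_zero_of_chain ρ hm (hGS ζ hζ x hx)).le) hs

/-- **Chained ground states empty the short-chain class (PROVED; one exterior, no separation hypothesis on `G`):** the bound holds on an
open neighbourhood of the given exterior `ζ` (via the closed family `closure {ζ}`, thermodynamically identical to `ζ`). -/
theorem kernel_typChain_le_of_groundStatesChained_at (hρ : Continuous ρ) {θ m : ℝ} (hm : 0 < m) (w : Fin 4 → ℤ → ℤ) (ℓ₀ : ℕ)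
    (c : Fin 4 → ℤ) {ζ : LGConfig 4 G} (hGS : GroundStatesChained ρ θ m w ℓ₀ c ζ) {s : ℝ} (hs : 0 < s) :
    ∃ O : Set (LGConfig 4 G), IsOpen O ∧ ζ ∈ O ∧ ∃ β₀ : ℝ, ∀ β : ℝ, β₀ ≤ β → ∀ ζ' ∈ O,
      (ymSpecification ρ β (regionEdges w {c}) ζ') (TypChain ρ θ w ℓ₀ c) ≤ ENNReal.ofReal s := by
  have hK : ∀ y ∈ closure ({ζ} : Set (LGConfig 4 G)), GroundStatesChained ρ θ m w ℓ₀ c y := by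
    intro y hy x hx
    have hx' : IsGroundState ρ (regionEdges w {c}) ζ x := (isGroundState_iff_of_mem_closure_singleton ρ hρ hy _ x).1 hx
    refine (hGS x hx').congr fun q _ => ?_
    exact (eq_of_mem_closure_singleton hy _
      (continuous_const.sub (continuous_plaquetteObs ρ hρ q.1 q.2.1.1 q.2.1.2) : Continuous (plaqAction (G := G) ρ q)) x).symm
  obtain ⟨O, hO, hKO, β₀, h⟩ := kernel_typChain_le_of_groundStatesChained ρ hρ hm w ℓ₀ c isClosed_closure hK hs
  exact ⟨O, hO, hKO (subset_closure (Set.mem_singleton ζ)), β₀, h⟩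

/-- **A forced plaquette is `θ`-bad with kernel probability `→ 1` (PROVED; on an open neighbourhood of the given exterior).** -/
theorem kernel_plaqClean_le_of_groundStatesForce_at (hρ : Continuous ρ) {θ m : ℝ} (hm : 0 < m) (w : Fin 4 → ℤ → ℤ) (c : Fin 4 → ℤ)
    (p : ZdPlaquette 4) {ζ : LGConfig 4 G} (hGS : GroundStatesForce ρ θ m w c p ζ) {s : ℝ} (hs : 0 < s) :
    ∃ O : Set (LGConfig 4 G), IsOpen O ∧ ζ ∈ O ∧ ∃ β₀ : ℝ, ∀ β : ℝ, β₀ ≤ β → ∀ ζ' ∈ O,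
      (ymSpecification ρ β (regionEdges w {c}) ζ') {σ : LGConfig 4 G | plaqAction ρ p σ < θ} ≤ ENNReal.ofReal s := by
  have hc : Continuous (plaqAction (G := G) ρ p) := continuous_const.sub (continuous_plaquetteObs ρ hρ p.1 p.2.1.1 p.2.1.2)
  have hK : ∀ y ∈ closure ({ζ} : Set (LGConfig 4 G)), GroundStatesForce ρ θ m w c p y := by
    intro y hy x hx
    rw [eq_of_mem_closure_singleton hy _ hc x]
    exact hGS x ((isGroundState_iff_of_mem_closure_singleton ρ hρ hy _ x).1 hx)
  obtain ⟨O, hO, hKO, β₀, h⟩ := kernel_measure_le_of_groundStates ρ hρ (regionEdges w {c}) isClosed_closure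
    (measurableSet_lt (measurable_plaqAction ρ hρ p) measurable_const)
    (g := fun U => 1 - softBad ρ θ m p U) (continuous_const.sub (continuous_softBad ρ hρ θ m p))
    (fun U hU => by simp only [Set.mem_setOf_eq] at hU; rw [softBad_eq_zero_of_lt ρ hm hU]; norm_num)
    (fun U => sub_nonneg.2 (softBad_le_one ρ θ m p U))
    (fun y hy x hx => by rw [softBad_eq_one_of_le ρ hm (hK y hy x hx), sub_self]) hs
  exact ⟨O, hO, hKO (subset_closure (Set.mem_singleton ζ)), β₀, h⟩

/-- **¬(ii) AT A FIXED FRAME from chained ground states under a guard-clean exterior (PROVED).**  If `ζ` is short-chain typical on the `3⁴ − 1`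
cells around `c` (the format's guard — met by any exterior without `θ`-bad plaquettes there, `mem_typChain_of_forall_lt`) and the ground
states of the cell `c` at `ζ` are chained, then for every budget `0 ≤ δ < 1` clause (ii) in UKP form FAILS for `TypChain ρ θ w ℓ₀` on the
frame `w` at all large `β` (instance `F = F' = {c}`, exterior `ζ`).  FIXED MESH: `β₀` depends on `(w, c, ζ)` through compactness. -/
theorem not_clauseIIukp_typChain_of_groundStatesChained (hρ : Continuous ρ) {θ m : ℝ} (hm : 0 < m) (w : Fin 4 → ℤ → ℤ) (ℓ₀ : ℕ)
    (c : Fin 4 → ℤ) {ζ : LGConfig 4 G} (hguard : ∀ c' : Fin 4 → ℤ, c' ≠ c → (∀ i, |c' i - c i| ≤ 1) → ζ ∈ TypChain ρ θ w ℓ₀ c')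
    (hGS : GroundStatesChained ρ θ m w ℓ₀ c ζ) {δ : ℝ} (hδ0 : 0 ≤ δ) (hδ : δ < 1) :
    ∃ β₀ : ℝ, ∀ β : ℝ, β₀ ≤ β → ¬ ClauseIIukp ρ β w δ (TypChain ρ θ w ℓ₀) := by
  obtain ⟨O, -, hζO, β₀, h⟩ := kernel_typChain_le_of_groundStatesChained_at ρ hρ hm w ℓ₀ c hGS (s := (1 - δ) / 2) (by linarith)
  refine ⟨β₀, fun β hβ hII => ?_⟩
  haveI := isProbabilityMeasure_ymSpecification ρ hρ β (regionEdges w {c}) ζ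
  have hle := hII {c} {c} (Finset.Subset.refl _) (Finset.singleton_nonempty c) ζ
    (fun c₁ hc₁ c' hc' => by
      rw [Finset.mem_singleton.1 hc₁] at hc'
      by_cases h' : c' = c
      · exact Or.inl (Finset.mem_singleton.2 h')
      · exact Or.inr (hguard c' h' hc'))
  have hset : {σ : LGConfig 4 G | ∀ c₁ ∈ ({c} : Finset (Fin 4 → ℤ)), σ ∉ TypChain ρ θ w ℓ₀ c₁} = (TypChain ρ θ w ℓ₀ c)ᶜ := by
    ext σ; simp
  rw [hset, Finset.card_singleton, pow_one, prob_compl_eq_one_sub (measurableSet_typChain ρ hρ θ w ℓ₀ c)] at hle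
  have h1 : (1 : ENNReal) ≤ ENNReal.ofReal δ + ENNReal.ofReal ((1 - δ) / 2) :=
    (tsub_le_iff_right.1 hle).trans (add_le_add le_rfl (h β hβ ζ hζO))
  rw [← ENNReal.ofReal_add hδ0 (by linarith), ← ENNReal.ofReal_one] at h1
  have h2 := (ENNReal.ofReal_le_ofReal_iff (by linarith)).1 h1
  linarith

/-- **¬(kernel plaquette sparseness) AT A FIXED FRAME from ONE forced plaquette (PROVED).**  If the ground states of the cell `c` at the
guard-clean exterior `ζ` force the own plaquette `p ∈ cellPlaqs w c` to action `≥ θ + m`, then `KernelPlaqSparse ρ β w θ ℓ₀ q` FAILS for every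
base `0 ≤ q < 1` at all large `β` (instance `F = F' = {c}`, `X = {p}`): the forced plaquette is `θ`-bad with kernel probability `→ 1`. -/
theorem not_kernelPlaqSparse_of_groundStatesForce (hρ : Continuous ρ) {θ m : ℝ} (hm : 0 < m) (w : Fin 4 → ℤ → ℤ) (ℓ₀ : ℕ)
    (c : Fin 4 → ℤ) {p : ZdPlaquette 4} (hp : p ∈ cellPlaqs w c) {ζ : LGConfig 4 G}
    (hguard : ∀ c' : Fin 4 → ℤ, c' ≠ c → (∀ i, |c' i - c i| ≤ 1) → ζ ∈ TypChain ρ θ w ℓ₀ c') (hGS : GroundStatesForce ρ θ m w c p ζ)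
    {q : ℝ} (hq0 : 0 ≤ q) (hq : q < 1) :
    ∃ β₀ : ℝ, ∀ β : ℝ, β₀ ≤ β → ¬ KernelPlaqSparse ρ β w θ ℓ₀ q := by
  obtain ⟨O, -, hζO, β₀, h⟩ := kernel_plaqClean_le_of_groundStatesForce_at ρ hρ hm w c p hGS (s := (1 - q) / 2) (by linarith)
  refine ⟨β₀, fun β hβ hK => ?_⟩
  haveI := isProbabilityMeasure_ymSpecification ρ hρ β (regionEdges w {c}) ζ
  have hle := hK {c} {c} (Finset.Subset.refl _) (Finset.singleton_nonempty c) ζ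
    (fun c₁ hc₁ c' hc' => by
      rw [Finset.mem_singleton.1 hc₁] at hc'
      by_cases h' : c' = c
      · exact Or.inl (Finset.mem_singleton.2 h')
      · exact Or.inr (hguard c' h' hc')) {p}
    (by rw [Finset.singleton_biUnion]; exact Finset.singleton_subset_iff.2 hp)
  have hset : {σ : LGConfig 4 G | ∀ p₁ ∈ ({p} : Finset (ZdPlaquette 4)), θ ≤ plaqAction ρ p₁ σ} =
      {σ : LGConfig 4 G | plaqAction ρ p σ < θ}ᶜ := by
    ext σ; simp [not_lt]
  rw [hset, Finset.card_singleton, pow_one,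
    prob_compl_eq_one_sub (measurableSet_lt (measurable_plaqAction ρ hρ p) measurable_const)] at hle
  have h1 : (1 : ENNReal) ≤ ENNReal.ofReal q + ENNReal.ofReal ((1 - q) / 2) :=
    (tsub_le_iff_right.1 hle).trans (add_le_add le_rfl (h β hβ ζ hζO))
  rw [← ENNReal.ofReal_add hq0 (by linarith), ← ENNReal.ofReal_one] at h1
  have h2 := (ENNReal.ofReal_le_ofReal_iff (by linarith)).1 h1
  linarith

end FixedFrame

end Summit.QuantumFields.YangMills.Cruxes.IR.AfPincerUc.SharpLanes.GroundStateForcing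

end
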